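/-
Copyright (c) 2026 the pub-hodgecm-mathlib formalisation cell (harness21).  Track B «K2-LIT» prover seat hodgecm-mathlib-K2E4-p14 (g4), 2026-09-04:
‹S› ROAD J, road (d-w) of K2E3-p03 (g3), brick (C2b-ii) FILE A2a — RESIDUE COUNTS for the order unit group `Λ^×` of `⟨1,−ξ⟩`: `[Λ^× : G₁] = (q−1)q`, `[G_k : G_{k′}] = q^{2(k′−k)}`,
and the group-theoretic twin `[H ⊔ N : H] = [N : H ∩ N]` (`N` normal).
-/
import Summits.HodgeConjecture.HodgeConjecture.Theorems.K2E3WildOrderUnitGroup       -- ★ FILE A1 (this seat): the order unit group `Λ^×`, its levels, the transfer letter `level_inv_mul_iff`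
import Literature.NumberTheory.LocalFields.RamifiedQuadraticResidueCountsUnits     -- ★ `relIndex_ball_ball_eq_pow` (`[𝔭^k : 𝔭^{k′}] = q^{k′−k}`); brings ★ ball currency `Valuation.leAddSubgroup`
import Literature.NumberTheory.LocalFields.WildQuadraticDatumNormGradedSteps       -- ★ `exists_fixed_v_sub_le`, `mem_maximalIdeal_iff_v_lt_one`; brings ★ `exists_valued_mul_self_sub_lt_one_of_finite_residueField`
import HarnessLib

/-!
# Residue counts for the unit group `Λ^×` of the order `Λ = 𝒪_E ⊕ 𝒪_E·j` of `⟨1,−ξ⟩` at a ramified quadratic datum: `[Λ^× : G₁] = (q−1)q`, `[G_k : G_{k′}] = q^{2(k′−k)}`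
# (Serre, *Local Fields* IV §2 Prop. 6; Riehm 1970 §1)

Cell `pub/hodgecm-mathlib`, Track B «K2-LIT», crux H413 = `stmt-HodgeConjecture-24833` (supports-only, `--as helper`, count-neutral); ‹S› ROAD J, road (d-w) of ‹J3› v2 (owner
K2E3-p03 (g3)); letter (C2) `sig_K2E3WildAnisotropicResidualCount`, brick **(C2b-ii) `[Λ¹ : Λ¹(4Λ)] = q^{6m−⌊d∕2⌋}`** (this seat; road owner 03:36:47Z (2), dealer K2E3-plan (g3) 03:38:10Z
(R2); census 03:39:19Z «=» 03:41:14Z).  THEOREMS ONLY (no `def`, no `instance`, no notation, no named fact, no `sorry`).  FILE A2a of the road `[ker f : ker f ∩ N] = [G : N] ∕ [f(G) : f(N)]`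
(A1 ★ p857193 `K2E3WildOrderUnitGroup`, A1b ★ p857217 `K2E3WildOrderUnitGroupNormImage`, A2b `K2E3WildOrderNormOneLevelCount` = assembly, B = CM dress).  Currency = ★ A1's membership
letters for `G = Λ^× ≤ GL₂(K)` (shape `[[a, ξσc],[c, σa]]`, `a, c` integral, `|det| = 1`) and its levels `G_k` (`|g₀₀ − 1|, |g₁₀| ≤ exp(−k)`); `q = #𝓀[K]`.
* §1 **`relIndex_sup_eq_relIndex_of_normal`**: `H.relIndex (H ⊔ N) = H.relIndex N` for `N` NORMAL, `H` arbitrary — `[HN : H] = [N : H ∩ N]`, the twin of Mathlib's `Subgroup.relIndex_sup_right`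
  (which quotients by the normal factor); needed because the level `N = 1 + 4Λ` is the arbitrary one and `Λ¹ = ker det` the normal one in `[Λ¹ : Λ¹ ∩ N]·[det Λ^× : det N] = [Λ^× : N]`.
* §2 **`relIndex_level_eq_pow`**: `[G_k : G_{k′}] = q^{2(k′−k)}` (`1 ≤ k ≤ k′`) — `g ↦ (g₀₀ − 1, g₁₀) mod 𝔭^{k′}` is a bijection `G_k ∕ G_{k′} ≃ (𝔭^k ∕ 𝔭^{k′})²` (injective on cosets by the ★
  transfer letter, onto via `M(1+x, y)`); **`relIndex_level_one_eq`**: `[G : G₁] = (q−1)·q` — `G ∕ G₁ ↪ 𝓀²` with image the complement of the kernel of the ADDITIVE map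
  `ψ(ā,c̄) = ā² − ξ̄c̄²` (residue characteristic `2`; `det M(a,c) ≡ ā² − ξ̄c̄²` as `σ` is residually trivial, ★ `exists_fixed_v_sub_le`), `ψ` onto (★ every residue is a square), `#ker ψ = q`.
  RESIDUE COUNTING ONLY — no Hensel lifting anywhere (every residue class that can occur is hit by an explicit shape matrix).
HONEST LABEL: HC_CM is proved only modulo the 7 printed citations (2 remaining named inputs: hLiu418 = `stmt-HodgeConjecture-24832`, h413 = `stmt-HodgeConjecture-24833`) until rung 0
closes; count-neutral local algebra; (C2b-ii)∕(C2)∕(W3) are NOT proved in this file.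

## References
* [Serre1979] J.-P. Serre, *Local Fields*, GTM 67 (1979), Ch. IV §2 Prop. 6 (`U∕U¹ ≅ 𝓀^×`, `Uⁿ∕Uⁿ⁺¹ ≅ 𝓀`), Ch. I §6 Prop. 18 (totally ramified: same residue field).
* [Riehm1970] C. Riehm, *The norm 1 group of a 𝔭-adic division algebra*, Amer. J. Math. 92 (1970), §1 (filtrations of the unit group of a local order).
* [Kottwitz1988] R. E. Kottwitz, *Tamagawa numbers*, Ann. of Math. 127 (1988), §1 Thm. 1.
-/

set_option autoImplicit false
set_option linter.dupNamespace false

noncomputable section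

open WithZero Matrix
open scoped Valued MatrixGroups Pointwise
open Literature.NumberTheory.Automorphic.UnitaryThreeFourFrame (IsRamifiedQuadraticDatum)
open Literature.NumberTheory.LocalFields.WildQuadraticDatum
open Literature.NumberTheory.LocalFields (exists_valued_mul_self_sub_lt_one_of_finite_residueField)
open Summit.HodgeConjecture.HodgeConjecture.Cruxes.H413.K2E3WildOrderUnitGroup

namespace Summit.HodgeConjecture.HodgeConjecture.Cruxes.H413.K2E3WildOrderResidueCounts

/-! ## §1 Group theory: `[H ⊔ N : H] = [N : H ∩ N]` for `N` normal (the twin of Mathlib's `relIndex_sup_right`, which quotients by the normal factor) -/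

/-- **`H.relIndex (H ⊔ N) = H.relIndex N` for a NORMAL subgroup `N`** (`H` arbitrary): the left cosets of `H` in `HN = NH` are represented by `N`, and `nH = n′H ⟺ n⁻¹n′ ∈ H ∩ N`.
(Mathlib's `Subgroup.relIndex_sup_right` is the other second-isomorphism count `[H ⊔ N : N] = [H : H ∩ N]`.) [folklore] -/
theorem relIndex_sup_eq_relIndex_of_normal {Γ : Type*} [Group Γ] (H N : Subgroup Γ) [hN : N.Normal] : H.relIndex (H ⊔ N) = H.relIndex N := by
  rw [Subgroup.relIndex, Subgroup.relIndex, Subgroup.index_eq_card, Subgroup.index_eq_card]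
  have hle : N ≤ H ⊔ N := le_sup_right
  -- the map induced by the inclusion `N ≤ H ⊔ N`
  have hcompat : ∀ a b : N, QuotientGroup.leftRel (H.subgroupOf N) a b →
      QuotientGroup.leftRel (H.subgroupOf (H ⊔ N)) (Subgroup.inclusion hle a) (Subgroup.inclusion hle b) := by
    intro a b hab
    rw [QuotientGroup.leftRel_apply, Subgroup.mem_subgroupOf] at hab ⊢
    simpa only [Subgroup.coe_mul, Subgroup.coe_inv, Subgroup.coe_inclusion] using hab
  refine (Nat.card_congr (Equiv.ofBijective (Quotient.map' (Subgroup.inclusion hle) hcompat) ⟨?_, ?_⟩)).symm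
  · intro x y hxy
    induction x using Quotient.inductionOn' with
    | h a =>
      induction y using Quotient.inductionOn' with
      | h b =>
        have h := Quotient.exact' hxy
        rw [QuotientGroup.leftRel_apply, Subgroup.mem_subgroupOf] at h
        refine Quotient.sound' ?_
        rw [QuotientGroup.leftRel_apply, Subgroup.mem_subgroupOf]
        simpa only [Subgroup.coe_mul, Subgroup.coe_inv, Subgroup.coe_inclusion] using h
  · intro x
    induction x using Quotient.inductionOn' with
    | h a =>
      have ha : (a : Γ) ∈ (H : Set Γ) * (N : Set Γ) := by rw [← Subgroup.mul_normal H N]; exact a.2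
      obtain ⟨h, hh, n, hn, hhn⟩ := Set.mem_mul.1 ha
      refine ⟨Quotient.mk'' ⟨h * n * h⁻¹, hN.conj_mem n hn h⟩, ?_⟩
      change Quotient.mk'' (Subgroup.inclusion hle ⟨h * n * h⁻¹, hN.conj_mem n hn h⟩) = Quotient.mk'' a
      refine Quotient.sound' ?_
      rw [QuotientGroup.leftRel_apply, Subgroup.mem_subgroupOf]
      simp only [Subgroup.coe_mul, Subgroup.coe_inv, Subgroup.coe_inclusion, ← hhn]
      rw [show (h * n * h⁻¹)⁻¹ * (h * n) = h by group]
      exact hh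

/-! ## §2 Residue counts: `[G : G₁] = (q−1)·q` and `[G_k : G_{k′}] = q^{2(k′−k)}` -/

section Counts

variable {K : Type} [Field K] [Valued K ℤᵐ⁰] {σ : K →+* K} {ϖ ξ : K} {d t : ℕ}

/-- In `ℤᵐ⁰`: `x < 1 ↔ x ≤ exp(−1)`. [cite: Serre1979, Ch. II §1] -/
theorem lt_one_iff_le_exp_neg_one {x : ℤᵐ⁰} : x < 1 ↔ x ≤ exp (-1 : ℤ) := by
  rcases eq_or_ne x 0 with rfl | hx
  · exact ⟨fun _ => zero_le, fun _ => zero_lt_one⟩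
  · obtain ⟨n, rfl⟩ : ∃ n : ℤ, x = exp n := ⟨_, (exp_log hx).symm⟩
    rw [← exp_zero, exp_lt_exp, exp_le_exp]; omega

/-- `σ` IS RESIDUALLY TRIVIAL at a ramified datum: `|σx − x| < 1` for every integer `x` (★ `exists_fixed_v_sub_le`: `x` is within `|ϖ|` of a fixed integer). [cite: Serre1979, Ch. I §6 Prop. 18] -/
theorem valued_map_sub_self_lt_one (hD : IsRamifiedQuadraticDatum σ ϖ d t) {x : K} (hx : Valued.v x ≤ 1) : Valued.v (σ x - x) < 1 := by
  obtain ⟨hσ, hvσ, hϖ, hfix, hd, -, -⟩ := hD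
  obtain ⟨a, hσa, -, hxa⟩ := exists_fixed_v_sub_le hσ hfix hϖ hd hx
  have hϖ1 : exp (-1 : ℤ) < (1 : ℤᵐ⁰) := by rw [← exp_zero, exp_lt_exp]; norm_num
  rw [show σ x - x = σ (x - a) - (x - a) by rw [map_sub, hσa]; ring]
  refine lt_of_le_of_lt (Valuation.map_sub _ _ _) (max_lt ?_ (lt_of_le_of_lt hxa hϖ1))
  rw [hvσ]; exact lt_of_le_of_lt hxa hϖ1

/-- **`[G_k : G_{k′}] = q^{2(k′−k)}`** (`1 ≤ k ≤ k′`): `g ↦ (g₀₀ − 1, g₁₀) mod 𝔭^{k′}` identifies `G_k ∕ G_{k′}` with `(𝔭^k ∕ 𝔭^{k′})²` — injective on cosets by the ★ transfer letter, onto since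
`M(1 + x, y) ∈ G_k` for all `x, y ∈ 𝔭^k` (`k ≥ 1` makes the determinant a unit); `[𝔭^k : 𝔭^{k′}] = q^{k′−k}` (★ `relIndex_ball_ball_eq_pow`). [cite: Riehm1970, §1] [cite: Serre1979, Ch. IV §2 Prop. 6] -/
theorem relIndex_level_eq_pow (hD : IsRamifiedQuadraticDatum σ ϖ d t) [Finite 𝓀[K]] (hξ1 : Valued.v ξ = 1)
    {G : Subgroup (GL (Fin 2) K)}
    (hG : ∀ g : GL (Fin 2) K, g ∈ G ↔
      ((g : Matrix (Fin 2) (Fin 2) K) 0 1 = ξ * σ ((g : Matrix (Fin 2) (Fin 2) K) 1 0) ∧ (g : Matrix (Fin 2) (Fin 2) K) 1 1 = σ ((g : Matrix (Fin 2) (Fin 2) K) 0 0) ∧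
        Valued.v ((g : Matrix (Fin 2) (Fin 2) K) 0 0) ≤ 1 ∧ Valued.v ((g : Matrix (Fin 2) (Fin 2) K) 1 0) ≤ 1 ∧ Valued.v (g : Matrix (Fin 2) (Fin 2) K).det = 1))
    {k k' : ℕ} (hk : 1 ≤ k) (hkk' : k ≤ k') {Gk Gk' : Subgroup (GL (Fin 2) K)}
    (hGk : ∀ g : GL (Fin 2) K, g ∈ Gk ↔
      g ∈ G ∧ Valued.v ((g : Matrix (Fin 2) (Fin 2) K) 0 0 - 1) ≤ exp (-(k : ℤ)) ∧ Valued.v ((g : Matrix (Fin 2) (Fin 2) K) 1 0) ≤ exp (-(k : ℤ)))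
    (hGk' : ∀ g : GL (Fin 2) K, g ∈ Gk' ↔
      g ∈ G ∧ Valued.v ((g : Matrix (Fin 2) (Fin 2) K) 0 0 - 1) ≤ exp (-(k' : ℤ)) ∧ Valued.v ((g : Matrix (Fin 2) (Fin 2) K) 1 0) ≤ exp (-(k' : ℤ))) :
    Gk'.relIndex Gk = Nat.card 𝓀[K] ^ (2 * (k' - k)) := by
  classical
  have hD' := hD
  obtain ⟨hσ, hvσ, hϖ, -, -, -, -⟩ := hD'
  have hk1 : exp (-(k : ℤ)) < (1 : ℤᵐ⁰) := by rw [← exp_zero, exp_lt_exp]; omega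
  set B : AddSubgroup K := (Valued.v : Valuation K ℤᵐ⁰).leAddSubgroup (exp (-(k : ℤ))) with hB
  set B' : AddSubgroup K := (Valued.v : Valuation K ℤᵐ⁰).leAddSubgroup (exp (-(k' : ℤ))) with hB'
  have hidx : (B'.addSubgroupOf B).index = Nat.card 𝓀[K] ^ (k' - k) := relIndex_ball_ball_eq_pow hϖ hkk'
  -- the map `φ : G_k → (𝔭^k ∕ 𝔭^{k′})²`
  have hmemB : ∀ g : Gk, ((g : GL (Fin 2) K) : Matrix (Fin 2) (Fin 2) K) 0 0 - 1 ∈ B ∧ ((g : GL (Fin 2) K) : Matrix (Fin 2) (Fin 2) K) 1 0 ∈ B := fun g => by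
    obtain ⟨-, ha, hc⟩ := (hGk g).1 g.2
    exact ⟨Valuation.mem_leAddSubgroup_iff.2 ha, Valuation.mem_leAddSubgroup_iff.2 hc⟩
  let φ : Gk → (B ⧸ B'.addSubgroupOf B) × (B ⧸ B'.addSubgroupOf B) := fun g =>
    (QuotientAddGroup.mk ⟨_, (hmemB g).1⟩, QuotientAddGroup.mk ⟨_, (hmemB g).2⟩)
  -- (1) `φ g = φ g′ ↔ g⁻¹g′ ∈ G_{k′}` (transfer letter)
  have hφ : ∀ g g' : Gk, φ g = φ g' ↔ g⁻¹ * g' ∈ Gk'.subgroupOf Gk := by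
    intro g g'
    have hgG : (g : GL (Fin 2) K) ∈ G := ((hGk g).1 g.2).1
    have hg'G : (g' : GL (Fin 2) K) ∈ G := ((hGk g').1 g'.2).1
    rw [Subgroup.mem_subgroupOf, hGk', Subgroup.coe_mul, Subgroup.coe_inv, Prod.ext_iff]
    change (QuotientAddGroup.mk _ : B ⧸ B'.addSubgroupOf B) = QuotientAddGroup.mk _ ∧ (QuotientAddGroup.mk _ : B ⧸ B'.addSubgroupOf B) = QuotientAddGroup.mk _ ↔ _
    rw [QuotientAddGroup.eq, QuotientAddGroup.eq, AddSubgroup.mem_addSubgroupOf, AddSubgroup.mem_addSubgroupOf]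
    change -(((g : GL (Fin 2) K) : Matrix (Fin 2) (Fin 2) K) 0 0 - 1) + (((g' : GL (Fin 2) K) : Matrix (Fin 2) (Fin 2) K) 0 0 - 1) ∈ B' ∧
      -((g : GL (Fin 2) K) : Matrix (Fin 2) (Fin 2) K) 1 0 + ((g' : GL (Fin 2) K) : Matrix (Fin 2) (Fin 2) K) 1 0 ∈ B' ↔ _
    rw [Valuation.mem_leAddSubgroup_iff, Valuation.mem_leAddSubgroup_iff,
      show -(((g : GL (Fin 2) K) : Matrix (Fin 2) (Fin 2) K) 0 0 - 1) + (((g' : GL (Fin 2) K) : Matrix (Fin 2) (Fin 2) K) 0 0 - 1) =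
        ((g' : GL (Fin 2) K) : Matrix (Fin 2) (Fin 2) K) 0 0 - ((g : GL (Fin 2) K) : Matrix (Fin 2) (Fin 2) K) 0 0 by ring,
      show -((g : GL (Fin 2) K) : Matrix (Fin 2) (Fin 2) K) 1 0 + ((g' : GL (Fin 2) K) : Matrix (Fin 2) (Fin 2) K) 1 0 =
        ((g' : GL (Fin 2) K) : Matrix (Fin 2) (Fin 2) K) 1 0 - ((g : GL (Fin 2) K) : Matrix (Fin 2) (Fin 2) K) 1 0 by ring,
      ← level_inv_mul_iff hvσ hξ1 hG hgG hg'G (exp (-(k' : ℤ)))]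
    exact ⟨fun h => ⟨G.mul_mem (G.inv_mem hgG) hg'G, h⟩, fun h => h.2⟩
  -- (2) `φ` is onto: `M(1 + x, y)` for `x, y ∈ 𝔭^k`
  have hφsurj : Function.Surjective φ := by
    rintro ⟨qx, qy⟩
    induction qx using QuotientAddGroup.induction_on with
    | H x =>
      induction qy using QuotientAddGroup.induction_on with
      | H y =>
        have hx : Valued.v (x : K) ≤ exp (-(k : ℤ)) := Valuation.mem_leAddSubgroup_iff.1 x.2
        have hy : Valued.v (y : K) ≤ exp (-(k : ℤ)) := Valuation.mem_leAddSubgroup_iff.1 y.2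
        have hx1 : Valued.v (x : K) < 1 := lt_of_le_of_lt hx hk1
        have hy1 : Valued.v (y : K) < 1 := lt_of_le_of_lt hy hk1
        set M : Matrix (Fin 2) (Fin 2) K := !![1 + x, ξ * σ y; y, σ (1 + x)] with hM
        have h01 : M 0 1 = ξ * σ (M 1 0) := by simp [hM]
        have h11 : M 1 1 = σ (M 0 0) := by simp [hM]
        have hdet : M.det = 1 + (((x : K) + σ x + x * σ x) - ξ * (y * σ y)) := by
          rw [det_of_shape h01 h11]; simp only [hM, Matrix.of_apply, Matrix.cons_val', Matrix.cons_val_zero, Matrix.cons_val_one, Matrix.cons_val_fin_one, map_add, map_one]; ring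
        have hdet1 : Valued.v M.det = 1 := by
          rw [hdet]
          refine Valuation.map_one_add_of_lt _ (lt_of_le_of_lt (Valuation.map_sub _ _ _) (max_lt ?_ ?_))
          · refine lt_of_le_of_lt (Valuation.map_add _ _ _) (max_lt (lt_of_le_of_lt (Valuation.map_add _ _ _) (max_lt hx1 (by rw [hvσ]; exact hx1))) ?_)
            rw [map_mul, hvσ]; exact mul_lt_one_of_nonneg_of_lt_one_left zero_le hx1 hx1.le
          · rw [map_mul, hξ1, one_mul, map_mul, hvσ]; exact mul_lt_one_of_nonneg_of_lt_one_left zero_le hy1 hy1.le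
        have hdet0 : M.det ≠ 0 := fun h => by rw [h, map_zero] at hdet1; exact zero_ne_one hdet1
        have hgG : Matrix.GeneralLinearGroup.mkOfDetNeZero M hdet0 ∈ G := by
          refine (hG _).2 ⟨h01, h11, ?_, hy.trans hk1.le, hdet1⟩
          change Valued.v (M 0 0) ≤ 1
          simp only [hM, Matrix.of_apply, Matrix.cons_val', Matrix.cons_val_zero, Matrix.cons_val_fin_one]
          exact (Valuation.map_add _ _ _).trans (max_le (by rw [map_one]) hx1.le)
        have hgk : Matrix.GeneralLinearGroup.mkOfDetNeZero M hdet0 ∈ Gk := by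
          refine (hGk _).2 ⟨hgG, ?_, ?_⟩
          · change Valued.v (M 0 0 - 1) ≤ _; simp only [hM, Matrix.of_apply, Matrix.cons_val', Matrix.cons_val_zero, Matrix.cons_val_fin_one, add_sub_cancel_left]; exact hx
          · change Valued.v (M 1 0) ≤ _; simp only [hM, Matrix.of_apply, Matrix.cons_val', Matrix.cons_val_zero, Matrix.cons_val_one, Matrix.cons_val_fin_one]; exact hy
        refine ⟨⟨_, hgk⟩, Prod.ext ?_ ?_⟩
        · change (QuotientAddGroup.mk _ : B ⧸ B'.addSubgroupOf B) = QuotientAddGroup.mk x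
          congr 1; apply Subtype.ext
          change M 0 0 - 1 = x
          simp [hM]
        · change (QuotientAddGroup.mk _ : B ⧸ B'.addSubgroupOf B) = QuotientAddGroup.mk y
          congr 1
  -- (3) descend `φ` to a bijection `G_k ∕ G_{k′} ≃ (𝔭^k∕𝔭^{k′})²`
  let φbar : Gk ⧸ Gk'.subgroupOf Gk → (B ⧸ B'.addSubgroupOf B) × (B ⧸ B'.addSubgroupOf B) :=
    Quotient.lift φ (fun a b hab => (hφ a b).2 (QuotientGroup.leftRel_apply.1 hab))
  have hφbar : Function.Bijective φbar := by
    constructor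
    · intro x y hxy
      induction x using Quotient.inductionOn with
      | h a =>
        induction y using Quotient.inductionOn with
        | h b => exact Quotient.sound (QuotientGroup.leftRel_apply.2 ((hφ a b).1 hxy))
    · intro z
      obtain ⟨g, hg⟩ := hφsurj z
      exact ⟨Quotient.mk _ g, hg⟩
  rw [Subgroup.relIndex, Subgroup.index_eq_card, Nat.card_congr (Equiv.ofBijective φbar hφbar), Nat.card_prod, ← AddSubgroup.index_eq_card, hidx, ← pow_two, ← pow_mul,
    mul_comm]

/-- **`[G : G₁] = (q − 1)·q`**: `g ↦ (ḡ₀₀, ḡ₁₀) ∈ 𝓀²` identifies `G ∕ G₁` (★ transfer letter: `ḡ = ḡ′ ⟺ g⁻¹g′ ∈ G₁`) with the pairs `(ā, c̄)` OFF THE KERNEL of the additive map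
`ψ(ā, c̄) = ā² − ξ̄c̄²` (residue characteristic `2`: `det M(a,c) = aσa − ξcσc ≡ ā² − ξ̄c̄²` since `σ` is residually trivial, and every such pair lifts); `ψ` is onto (every residue is a square,
★ `exists_valued_mul_self_sub_lt_one_of_finite_residueField`), so `#ker ψ = q` and `[G : G₁] = q² − q`. [cite: Riehm1970, §1] [cite: Serre1979, Ch. IV §2 Prop. 6] -/
theorem relIndex_level_one_eq (hD : IsRamifiedQuadraticDatum σ ϖ d t) [Finite 𝓀[K]] (h2v : Valued.v (2 : K) < 1) (hξ1 : Valued.v ξ = 1)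
    {G : Subgroup (GL (Fin 2) K)}
    (hG : ∀ g : GL (Fin 2) K, g ∈ G ↔
      ((g : Matrix (Fin 2) (Fin 2) K) 0 1 = ξ * σ ((g : Matrix (Fin 2) (Fin 2) K) 1 0) ∧ (g : Matrix (Fin 2) (Fin 2) K) 1 1 = σ ((g : Matrix (Fin 2) (Fin 2) K) 0 0) ∧
        Valued.v ((g : Matrix (Fin 2) (Fin 2) K) 0 0) ≤ 1 ∧ Valued.v ((g : Matrix (Fin 2) (Fin 2) K) 1 0) ≤ 1 ∧ Valued.v (g : Matrix (Fin 2) (Fin 2) K).det = 1))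
    {G₁ : Subgroup (GL (Fin 2) K)}
    (hG₁ : ∀ g : GL (Fin 2) K, g ∈ G₁ ↔
      g ∈ G ∧ Valued.v ((g : Matrix (Fin 2) (Fin 2) K) 0 0 - 1) ≤ exp (-((1 : ℕ) : ℤ)) ∧ Valued.v ((g : Matrix (Fin 2) (Fin 2) K) 1 0) ≤ exp (-((1 : ℕ) : ℤ))) :
    G₁.relIndex G = (Nat.card 𝓀[K] - 1) * Nat.card 𝓀[K] := by
  classical
  have hD' := hD
  obtain ⟨hσ, hvσ, hϖ, -, -, -, -⟩ := hD'
  have h1 : exp (-((1 : ℕ) : ℤ)) = exp (-1 : ℤ) := by norm_num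
  -- residue field of characteristic two
  have h2M : (2 : 𝒪[K]) ∈ 𝓂[K] := (mem_maximalIdeal_iff_v_lt_one _).2 (by exact_mod_cast h2v)
  haveI : CharP 𝓀[K] 2 := by
    refine CharTwo.of_one_ne_zero_of_two_eq_zero one_ne_zero ?_
    have h := (IsLocalRing.residue_eq_zero_iff (2 : 𝒪[K])).2 h2M
    rwa [map_ofNat] at h
  -- residues of integers, `σ` residually trivial
  have hres : ∀ (x y : 𝒪[K]), IsLocalRing.residue 𝒪[K] x = IsLocalRing.residue 𝒪[K] y ↔ Valued.v ((x : K) - y) < 1 := by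
    intro x y
    rw [← sub_eq_zero, ← map_sub, IsLocalRing.residue_eq_zero_iff, mem_maximalIdeal_iff_v_lt_one]
    rfl
  have hresσ : ∀ (x : 𝒪[K]) (hσx : Valued.v (σ x) ≤ 1), IsLocalRing.residue 𝒪[K] ⟨σ x, (Valuation.mem_integer_iff _ _).2 hσx⟩ = IsLocalRing.residue 𝒪[K] x :=
    fun x hσx => (hres _ _).2 (valued_map_sub_self_lt_one hD x.2)
  set ξO : 𝒪[K] := ⟨ξ, (Valuation.mem_integer_iff _ _).2 hξ1.le⟩ with hξO
  -- the additive map `ψ(ā, c̄) = ā² − ξ̄c̄²`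
  let ψ : 𝓀[K] × 𝓀[K] →+ 𝓀[K] := AddMonoidHom.mk' (fun p => p.1 * p.1 - IsLocalRing.residue 𝒪[K] ξO * (p.2 * p.2)) (by
    rintro ⟨a, c⟩ ⟨a', c'⟩
    simp only [Prod.fst_add, Prod.snd_add, CharTwo.add_mul_self]
    ring)
  have hψ : ∀ p : 𝓀[K] × 𝓀[K], ψ p = p.1 * p.1 - IsLocalRing.residue 𝒪[K] ξO * (p.2 * p.2) := fun p => rfl
  -- `#ker ψ = q` (ψ onto: every residue is a square)
  have hψsurj : Function.Surjective ψ := by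
    intro w
    obtain ⟨W, rfl⟩ := IsLocalRing.residue_surjective w
    obtain ⟨x, hx1, hxW⟩ := exists_valued_mul_self_sub_lt_one_of_finite_residueField h2v (W : K) W.2
    refine ⟨(IsLocalRing.residue 𝒪[K] ⟨x, (Valuation.mem_integer_iff _ _).2 hx1⟩, 0), ?_⟩
    rw [hψ, mul_zero, mul_zero, sub_zero, ← map_mul]
    exact (hres _ _).2 (by push_cast; exact hxW)
  have hker : Nat.card ψ.ker = Nat.card 𝓀[K] := by
    have h := AddSubgroup.card_mul_index ψ.ker
    rw [AddSubgroup.index_ker, AddMonoidHom.range_eq_top.2 hψsurj, AddSubgroup.card_top, Nat.card_prod] at h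
    exact Nat.eq_of_mul_eq_mul_right Nat.card_pos h
  -- the map `φ : G → 𝓀²`
  have hmemO : ∀ g : G, ((g : GL (Fin 2) K) : Matrix (Fin 2) (Fin 2) K) 0 0 ∈ 𝒪[K] ∧ ((g : GL (Fin 2) K) : Matrix (Fin 2) (Fin 2) K) 1 0 ∈ 𝒪[K] := fun g => by
    obtain ⟨-, -, ha, hc, -⟩ := (hG g).1 g.2
    exact ⟨(Valuation.mem_integer_iff _ _).2 ha, (Valuation.mem_integer_iff _ _).2 hc⟩
  let φ : G → 𝓀[K] × 𝓀[K] := fun g => (IsLocalRing.residue 𝒪[K] ⟨_, (hmemO g).1⟩, IsLocalRing.residue 𝒪[K] ⟨_, (hmemO g).2⟩)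
  -- (1) `φ g = φ g′ ↔ g⁻¹g′ ∈ G₁`
  have hφ : ∀ g g' : G, φ g = φ g' ↔ g⁻¹ * g' ∈ G₁.subgroupOf G := by
    intro g g'
    rw [Subgroup.mem_subgroupOf, hG₁, Subgroup.coe_mul, Subgroup.coe_inv, Prod.ext_iff, h1]
    change IsLocalRing.residue 𝒪[K] _ = IsLocalRing.residue 𝒪[K] _ ∧ IsLocalRing.residue 𝒪[K] _ = IsLocalRing.residue 𝒪[K] _ ↔ _
    rw [hres, hres, ← Valuation.map_neg _ ((_ : K) - _), neg_sub, ← Valuation.map_neg _ ((((g : GL (Fin 2) K) : Matrix (Fin 2) (Fin 2) K) 1 0 : K) - _), neg_sub,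
      lt_one_iff_le_exp_neg_one, lt_one_iff_le_exp_neg_one, ← level_inv_mul_iff hvσ hξ1 hG g.2 g'.2 (exp (-1 : ℤ))]
    exact ⟨fun h => ⟨G.mul_mem (G.inv_mem g.2) g'.2, h⟩, fun h => h.2⟩
  -- (2) range `φ` = the pairs off `ker ψ`
  have hrange : Set.range φ = (ψ.ker : Set (𝓀[K] × 𝓀[K]))ᶜ := by
    ext p
    simp only [Set.mem_compl_iff, SetLike.mem_coe, AddMonoidHom.mem_ker, Set.mem_range]
    constructor
    · rintro ⟨g, rfl⟩
      obtain ⟨h01, h11, ha, hc, hdet⟩ := (hG g).1 g.2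
      have hσaO : σ (((g : GL (Fin 2) K) : Matrix (Fin 2) (Fin 2) K) 0 0) ∈ 𝒪[K] := (Valuation.mem_integer_iff _ _).2 (by rw [hvσ]; exact ha)
      have hσcO : σ (((g : GL (Fin 2) K) : Matrix (Fin 2) (Fin 2) K) 1 0) ∈ 𝒪[K] := (Valuation.mem_integer_iff _ _).2 (by rw [hvσ]; exact hc)
      have hdetO : ((g : GL (Fin 2) K) : Matrix (Fin 2) (Fin 2) K).det ∈ 𝒪[K] := (Valuation.mem_integer_iff _ _).2 hdet.le
      have e : (⟨_, hdetO⟩ : 𝒪[K]) = ⟨_, (hmemO g).1⟩ * ⟨_, hσaO⟩ - ξO * (⟨_, (hmemO g).2⟩ * ⟨_, hσcO⟩) :=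
        Subtype.ext (by push_cast; exact det_of_shape h01 h11)
      have hval : ψ (φ g) = IsLocalRing.residue 𝒪[K] ⟨_, hdetO⟩ := by
        rw [e, map_sub, map_mul, map_mul, map_mul, hresσ ⟨_, (hmemO g).1⟩ (by rw [hvσ]; exact ha), hresσ ⟨_, (hmemO g).2⟩ (by rw [hvσ]; exact hc), hψ]
      rw [hval, IsLocalRing.residue_eq_zero_iff, mem_maximalIdeal_iff_v_lt_one]
      change ¬ Valued.v ((g : GL (Fin 2) K) : Matrix (Fin 2) (Fin 2) K).det < 1
      rw [hdet]; exact lt_irrefl 1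
    · intro hp
      obtain ⟨x, hx⟩ := IsLocalRing.residue_surjective p.1
      obtain ⟨y, hy⟩ := IsLocalRing.residue_surjective p.2
      set M : Matrix (Fin 2) (Fin 2) K := !![(x : K), ξ * σ y; y, σ x] with hM
      have h01 : M 0 1 = ξ * σ (M 1 0) := by simp [hM]
      have h11 : M 1 1 = σ (M 0 0) := by simp [hM]
      have hM00 : M 0 0 = x := by simp [hM]
      have hM10 : M 1 0 = y := by simp [hM]
      have hσx : Valued.v (σ (x : K)) ≤ 1 := by rw [hvσ]; exact x.2
      have hσy : Valued.v (σ (y : K)) ≤ 1 := by rw [hvσ]; exact y.2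
      have hσxO : σ (x : K) ∈ 𝒪[K] := (Valuation.mem_integer_iff _ _).2 hσx
      have hσyO : σ (y : K) ∈ 𝒪[K] := (Valuation.mem_integer_iff _ _).2 hσy
      have hdetle : Valued.v M.det ≤ 1 := by
        rw [det_of_shape h01 h11, hM00, hM10]
        refine (Valuation.map_sub _ _ _).trans (max_le ?_ ?_)
        · rw [map_mul]; exact mul_le_one' x.2 hσx
        · rw [map_mul, hξ1, one_mul, map_mul]; exact mul_le_one' y.2 hσy
      have hdetO : M.det ∈ 𝒪[K] := (Valuation.mem_integer_iff _ _).2 hdetle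
      have e : (⟨_, hdetO⟩ : 𝒪[K]) = x * ⟨_, hσxO⟩ - ξO * (y * ⟨_, hσyO⟩) :=
        Subtype.ext (by push_cast; rw [det_of_shape h01 h11, hM00, hM10])
      have hval : IsLocalRing.residue 𝒪[K] ⟨_, hdetO⟩ = ψ p := by
        rw [e, map_sub, map_mul, map_mul, map_mul, hresσ x hσx, hresσ y hσy, hψ, hx, hy]
      have hdet1 : Valued.v M.det = 1 := by
        refine le_antisymm hdetle (not_lt.1 fun hlt => hp ?_)
        rw [← hval, IsLocalRing.residue_eq_zero_iff, mem_maximalIdeal_iff_v_lt_one]; exact hlt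
      have hdet0 : M.det ≠ 0 := fun h => by rw [h, map_zero] at hdet1; exact zero_ne_one hdet1
      have hgG : Matrix.GeneralLinearGroup.mkOfDetNeZero M hdet0 ∈ G :=
        (hG _).2 ⟨h01, h11, by change Valued.v (M 0 0) ≤ 1; rw [hM00]; exact x.2, by change Valued.v (M 1 0) ≤ 1; rw [hM10]; exact y.2, hdet1⟩
      refine ⟨⟨_, hgG⟩, Prod.ext ?_ ?_⟩
      · change IsLocalRing.residue 𝒪[K] _ = p.1
        rw [← hx]; congr 1
      · change IsLocalRing.residue 𝒪[K] _ = p.2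
        rw [← hy]; congr 1
  -- (3) descend and count
  let φbar : G ⧸ G₁.subgroupOf G → Set.range φ :=
    Quotient.lift (fun g => (⟨φ g, g, rfl⟩ : Set.range φ)) (fun a b hab => Subtype.ext ((hφ a b).2 (QuotientGroup.leftRel_apply.1 hab)))
  have hφbar : Function.Bijective φbar := by
    constructor
    · intro x y hxy
      induction x using Quotient.inductionOn with
      | h a =>
        induction y using Quotient.inductionOn with
        | h b => exact Quotient.sound (QuotientGroup.leftRel_apply.2 ((hφ a b).1 (congrArg Subtype.val hxy)))
    · rintro ⟨_, g, rfl⟩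
      exact ⟨Quotient.mk _ g, rfl⟩
  have htot := Set.ncard_add_ncard_compl (ψ.ker : Set (𝓀[K] × 𝓀[K]))
  rw [← hrange, ← Nat.card_coe_set_eq, ← Nat.card_coe_set_eq, SetLike.coe_sort_coe, hker, Nat.card_prod] at htot
  rw [Subgroup.relIndex, Subgroup.index_eq_card, Nat.card_congr (Equiv.ofBijective φbar hφbar), Nat.sub_mul, one_mul, ← htot, Nat.add_sub_cancel_left]

end Counts

end Summit.HodgeConjecture.HodgeConjecture.Cruxes.H413.K2E3WildOrderResidueCounts

end
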